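import Summits.Ventures.YMGap.RobustBall.TorusPlaquetteStrictMono
import Summits.Ventures.YMGap.RobustBall.PlaquettePositivity
import HarnessLib

/-!
# Robust ball (Y2), strong-coupling laws — infinite volume, EVERY coupling: the mean-plaquette envelopes over the limit states are
# strictly increasing in the coupling, with a rate

HONEST FRAMING: venture file of the cell `pub-ymgap` (QuantumFields programme), track ROBUST-BALL, seat rb-p2 (g8).  LATTICE statements about the
infinite-volume limit states (`infiniteVolumeLimitPoints ρ β`: subsequential limits of the torus Wilson states) of a special unitary model
(`G ≅ SU(N)`, `N ≥ 2`, `d ≥ 2`) at ARBITRARY real couplings — no window, no uniqueness.  Since limit states at different couplings need not be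
unique, the statement is about states attained along a COMMON sequence of volumes: for every limit state `μ₁` at `β₁` there is a limit state `μ₂` at
`β₂ > β₁` (along a subsequence of the same volumes) whose mean plaquette exceeds that of `μ₁` by at least `rate · (β₂ − β₁)`, and symmetrically.
Consequently the upper and lower envelopes `sup_μ ⟨Re tr U_p⟩_μ`, `inf_μ ⟨Re tr U_p⟩_μ` over the limit states are strictly increasing in `β`.
Nothing about the continuum, a spectral gap or Clay; the rate is a one-link artefact.

MECHANISM: the finite-volume rate `planeSum_increment_ge` (every torus, every coupling; `TorusPlaquetteStrictMono`) + compactness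
(`FreeEnergyLaw.exists_isInfiniteVolumeLimitAlong_comp`, `tendsto_planeSum`) + translation/axis invariance of limit states
(`PlaquettePositivity.integral_plaquetteObs_eq`).  Everything here is proved. [folklore]
-/

noncomputable section

open MeasureTheory ProbabilityTheory Finset Function Filter Topology Set
open Literature.MathematicalPhysics.QuantumLattice Literature.MathematicalPhysics.QuantumFieldTheory

namespace Summit.Ventures.YMGap.RobustBall

namespace EnergyVariance

variable {d N : ℕ} {G : Type*} [Group G] [TopologicalSpace G] [IsTopologicalGroup G] [CompactSpace G]
  [MeasurableSpace G] [BorelSpace G] [SecondCountableTopology G] [T2Space G] (ρ : G →* Matrix (Fin N) (Fin N) ℂ)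

/-- ★★ **For every limit state at `β₁` there is a limit state at `β₂ > β₁`, along the same volumes, with a larger plane sum of plaquette
expectations by a definite amount**: `G ≅ SU(N)`, `N ≥ 2`, `d ≥ 2`, `−b ≤ β₁ < β₂ ≤ b`, `μ₁ ∈ infiniteVolumeLimitPoints ρ β₁` ⇒ there is
`μ₂ ∈ infiniteVolumeLimitPoints ρ β₂` with `Σ_{i<j}⟨Re tr U_{(0,ij)}⟩_{μ₂} − Σ_{i<j}⟨Re tr U_{(0,ij)}⟩_{μ₁} ≥ 2^{−d} e^{−8(d−1)Nb} V₀ (β₂ − β₁)`. [folklore] -/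
theorem exists_limitState_planeSum_ge (hρ : IsSpecialUnitaryModel ρ) (hN : 2 ≤ N) (hd : 2 ≤ d) {b β₁ β₂ : ℝ}
    (h₁ : β₁ ∈ Set.Icc (-b) b) (h₂ : β₂ ∈ Set.Icc (-b) b) (h12 : β₁ < β₂) {μ₁ : Measure (LGConfig d G)}
    (hμ₁ : μ₁ ∈ infiniteVolumeLimitPoints ρ β₁) :
    ∃ μ₂ ∈ infiniteVolumeLimitPoints ρ β₂,
      (1 / 2 : ℝ) ^ d * Real.exp (-(8 * (d - 1 : ℕ) * N * b)) * PlaquetteLowerBound.charVariance ρ * (β₂ - β₁) ≤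
        (∑ q : {q : Fin d × Fin d // q.1 < q.2}, ∫ U, plaquetteObs ρ (0 : Literature.Probability.LatticeModels.Site d) q.1.1 q.1.2 U ∂μ₂) -
          ∑ q : {q : Fin d × Fin d // q.1 < q.2}, ∫ U, plaquetteObs ρ (0 : Literature.Probability.LatticeModels.Site d) q.1.1 q.1.2 U ∂μ₁ := by
  obtain ⟨Ls, hLs, hlim₁⟩ := hμ₁
  obtain ⟨φ, μ₂, hφ, hlim₂⟩ := FreeEnergyLaw.exists_isInfiniteVolumeLimitAlong_comp (d := d) ρ hρ.1 β₂ Ls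
  refine ⟨μ₂, ⟨Ls ∘ φ, hLs.comp hφ, hlim₂⟩, ?_⟩
  have ht₁ := (FreeEnergyLaw.tendsto_planeSum (d := d) ρ hρ.1 hlim₁).comp hφ.tendsto_atTop
  have ht₂ := FreeEnergyLaw.tendsto_planeSum (d := d) ρ hρ.1 hlim₂
  refine le_of_tendsto_of_tendsto tendsto_const_nhds (ht₂.sub ht₁) ?_
  filter_upwards [eventually_ge_atTop 1] with k hk
  have hL : 1 ≤ (Ls ∘ φ) k := hk.trans ((hLs.comp hφ).id_le k)
  exact planeSum_increment_ge ρ hρ hN hd hL h₁ h₂ h12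

/-- ★★ **Symmetrically: for every limit state at `β₂` there is a limit state at `β₁ < β₂`, along the same volumes, with a smaller plane sum by a
definite amount.** [folklore] -/
theorem exists_limitState_planeSum_le (hρ : IsSpecialUnitaryModel ρ) (hN : 2 ≤ N) (hd : 2 ≤ d) {b β₁ β₂ : ℝ}
    (h₁ : β₁ ∈ Set.Icc (-b) b) (h₂ : β₂ ∈ Set.Icc (-b) b) (h12 : β₁ < β₂) {μ₂ : Measure (LGConfig d G)}
    (hμ₂ : μ₂ ∈ infiniteVolumeLimitPoints ρ β₂) :
    ∃ μ₁ ∈ infiniteVolumeLimitPoints ρ β₁,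
      (1 / 2 : ℝ) ^ d * Real.exp (-(8 * (d - 1 : ℕ) * N * b)) * PlaquetteLowerBound.charVariance ρ * (β₂ - β₁) ≤
        (∑ q : {q : Fin d × Fin d // q.1 < q.2}, ∫ U, plaquetteObs ρ (0 : Literature.Probability.LatticeModels.Site d) q.1.1 q.1.2 U ∂μ₂) -
          ∑ q : {q : Fin d × Fin d // q.1 < q.2}, ∫ U, plaquetteObs ρ (0 : Literature.Probability.LatticeModels.Site d) q.1.1 q.1.2 U ∂μ₁ := by
  obtain ⟨Ls, hLs, hlim₂⟩ := hμ₂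
  obtain ⟨φ, μ₁, hφ, hlim₁⟩ := FreeEnergyLaw.exists_isInfiniteVolumeLimitAlong_comp (d := d) ρ hρ.1 β₁ Ls
  refine ⟨μ₁, ⟨Ls ∘ φ, hLs.comp hφ, hlim₁⟩, ?_⟩
  have ht₂ := (FreeEnergyLaw.tendsto_planeSum (d := d) ρ hρ.1 hlim₂).comp hφ.tendsto_atTop
  have ht₁ := FreeEnergyLaw.tendsto_planeSum (d := d) ρ hρ.1 hlim₁
  refine le_of_tendsto_of_tendsto tendsto_const_nhds (ht₂.sub ht₁) ?_
  filter_upwards [eventually_ge_atTop 1] with k hk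
  have hL : 1 ≤ (Ls ∘ φ) k := hk.trans ((hLs.comp hφ).id_le k)
  exact planeSum_increment_ge ρ hρ hN hd hL h₁ h₂ h12

/-- The plane sum of a limit state is `#planes` times the expectation of ANY single plaquette (translation and axis invariance of limit states,
rb-p2 g3's `PlaquettePositivity.integral_plaquetteObs_eq`). [folklore] -/
theorem planeSum_limitState_eq (hρ : IsSpecialUnitaryModel ρ) (hd : 2 ≤ d) {β : ℝ} {μ : Measure (LGConfig d G)}
    (hμ : μ ∈ infiniteVolumeLimitPoints ρ β) (y : Literature.Probability.LatticeModels.Site d) {i j : Fin d} (hij : i ≠ j) :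
    (∑ q : {q : Fin d × Fin d // q.1 < q.2}, ∫ U, plaquetteObs ρ (0 : Literature.Probability.LatticeModels.Site d) q.1.1 q.1.2 U ∂μ) =
      (Fintype.card {q : Fin d × Fin d // q.1 < q.2} : ℝ) * ∫ U, plaquetteObs ρ y i j U ∂μ := by
  haveI : NeZero d := ⟨by omega⟩
  rw [PlaquettePositivity.integral_plaquetteObs_eq ρ hρ.1 hd hμ y hij]
  rw [Finset.sum_congr rfl fun q _ => PlaquettePositivity.integral_plaquetteObs_eq ρ hρ.1 hd hμ 0 (ne_of_lt q.2),
    Finset.sum_const, Finset.card_univ, nsmul_eq_mul]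

/-- ★★ **THE MEAN-PLAQUETTE ENVELOPES OVER THE LIMIT STATES ARE STRICTLY INCREASING IN THE COUPLING, with a rate** (`G ≅ SU(N)`, `N ≥ 2`, `d ≥ 2`,
every plaquette `(y; i ≠ j)`, `−b ≤ β₁ < β₂ ≤ b`): for every limit state `μ₁` at `β₁` there is a limit state `μ₂` at `β₂` with
`⟨Re tr U_p⟩_{μ₂} ≥ ⟨Re tr U_p⟩_{μ₁} + 2^{−d} e^{−8(d−1)Nb} V₀ (β₂ − β₁)/#planes`, and for every limit state `μ₂` at `β₂` there is a limit state `μ₁` at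
`β₁` with the same inequality. [folklore] -/
theorem limitState_plaquette_envelopes_increasing (hρ : IsSpecialUnitaryModel ρ) (hN : 2 ≤ N) (hd : 2 ≤ d)
    (y : Literature.Probability.LatticeModels.Site d) {i j : Fin d} (hij : i ≠ j) {b β₁ β₂ : ℝ}
    (h₁ : β₁ ∈ Set.Icc (-b) b) (h₂ : β₂ ∈ Set.Icc (-b) b) (h12 : β₁ < β₂) :
    (∀ μ₁ ∈ infiniteVolumeLimitPoints ρ β₁, ∃ μ₂ ∈ infiniteVolumeLimitPoints ρ β₂,
        (1 / 2 : ℝ) ^ d * Real.exp (-(8 * (d - 1 : ℕ) * N * b)) * PlaquetteLowerBound.charVariance ρ * (β₂ - β₁) /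
            (Fintype.card {q : Fin d × Fin d // q.1 < q.2} : ℝ) ≤
          (∫ U, plaquetteObs ρ y i j U ∂μ₂) - ∫ U, plaquetteObs ρ y i j U ∂μ₁) ∧
      (∀ μ₂ ∈ infiniteVolumeLimitPoints ρ β₂, ∃ μ₁ ∈ infiniteVolumeLimitPoints ρ β₁,
        (1 / 2 : ℝ) ^ d * Real.exp (-(8 * (d - 1 : ℕ) * N * b)) * PlaquetteLowerBound.charVariance ρ * (β₂ - β₁) /
            (Fintype.card {q : Fin d × Fin d // q.1 < q.2} : ℝ) ≤
          (∫ U, plaquetteObs ρ y i j U ∂μ₂) - ∫ U, plaquetteObs ρ y i j U ∂μ₁) := by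
  have hD : (0 : ℝ) < (Fintype.card {q : Fin d × Fin d // q.1 < q.2} : ℝ) := by
    have h01 : (⟨0, by omega⟩ : Fin d) < ⟨1, by omega⟩ := Fin.mk_lt_mk.2 (by norm_num)
    have : 0 < Fintype.card {q : Fin d × Fin d // q.1 < q.2} := Fintype.card_pos_iff.2 ⟨⟨(⟨0, by omega⟩, ⟨1, by omega⟩), h01⟩⟩
    exact_mod_cast this
  constructor
  · intro μ₁ hμ₁
    obtain ⟨μ₂, hμ₂, h⟩ := exists_limitState_planeSum_ge ρ hρ hN hd h₁ h₂ h12 hμ₁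
    refine ⟨μ₂, hμ₂, ?_⟩
    rw [planeSum_limitState_eq ρ hρ hd hμ₂ y hij, planeSum_limitState_eq ρ hρ hd hμ₁ y hij, ← mul_sub] at h
    rw [div_le_iff₀ hD]
    linarith
  · intro μ₂ hμ₂
    obtain ⟨μ₁, hμ₁, h⟩ := exists_limitState_planeSum_le ρ hρ hN hd h₁ h₂ h12 hμ₂
    refine ⟨μ₁, hμ₁, ?_⟩
    rw [planeSum_limitState_eq ρ hρ hd hμ₂ y hij, planeSum_limitState_eq ρ hρ hd hμ₁ y hij, ← mul_sub] at h
    rw [div_le_iff₀ hD]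
    linarith

end EnergyVariance

end Summit.Ventures.YMGap.RobustBall
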